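import Summits.AtomisticToContinuum.HydrodynamicLimit.Theorems.InformationPercolationEngineChaosClosesEulerReductionClassical
import HarnessLib

/-!
# Kinetic reduction (crux `ChaosClosesEuler`, stmt-AtomisticToContinuum-15141, line `Sketch`,
# stub `stub_kineticReduction`) — helper: the order of choices of the tolerances and the two budgets

WHAT. Pure real bookkeeping for the final assembly of the kinetic reduction. After the deterministic BF18 shell has
fixed its defect `δ` (for the horizon `H = t + (m+1)Δ'`, the short window `D = Δ'`, the clamp levels entering through
`M = max |a₁| |b₁|`), the thresholds lemma `reduction_thresholds_cold` asks for tolerances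
`ω, e, η₂, Lv, η₃, n, ωx, dX, n', lam, ηW, ηP, ηL, B3, ε₁` satisfying the momentum budget `hS2` and the entropy
budget `hS3`. Two of them are answered by inputs that are only callbacks here: the joint modulus of continuity of the
classical fields (`Hmod`, `HmodX`: a radius `d` for every level `ω`) and the uniform integrability of the quadratic
collision mark (`HU`: a velocity level `Lv` for every horizon shift `e` and tolerance `η₂`). `exists_tolerances` makes
all the choices in the right order — `ω → d → e → η₂ → Lv → (η₃, n) → ωx → dX → n' → lam` — and proves the two budgets
with every term at most `δ/8` resp. `δ/4`.

No named fact is invoked (the mesh lemma `exists_nat_mesh_le` of helper `ReductionClassical` is reused).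
-/

namespace Summit.AtomisticToContinuum.HydrodynamicLimit.Theorems.ChaosClosesEulerKineticReduction

/-- A quotient tolerance: for `0 ≤ K`, `0 ≤ b`, `b/(K+1) · K ≤ b`. [folklore] -/
theorem div_succ_mul_le {b K : ℝ} (hb : 0 ≤ b) (hK : 0 ≤ K) : b / (K + 1) * K ≤ b := by
  have hK1 : 0 < K + 1 := by linarith
  rw [div_mul_eq_mul_div, div_le_iff₀ hK1]
  nlinarith

/-- **Registered sub-goal `stub_reductionFinalA` (helper of `stub_kineticReduction`): a tolerance chosen below a
quotient pays its product** — `a ≤ b/(K+1)` gives `a K ≤ b` and `K a ≤ b` (`0 ≤ b`, `0 ≤ K`). [folklore] -/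
theorem stub_reductionFinalA : ∀ {a b K : ℝ}, 0 ≤ b → 0 ≤ K → a ≤ b / (K + 1) → a * K ≤ b ∧ K * a ≤ b := by
  intro a b K hb hK h
  have h1 : a * K ≤ b / (K + 1) * K := mul_le_mul_of_nonneg_right h hK
  have h2 := div_succ_mul_le hb hK
  constructor <;> nlinarith

set_option maxHeartbeats 1600000 in
/-- **THE ORDER OF CHOICES OF THE TOLERANCES AND THE TWO BUDGETS.** See the module docstring. [folklore] -/
theorem exists_tolerances {δ H D M C Cθ Cu KE B σ CY η₀g ηcap room : ℝ}
    (hδ : 0 < δ) (hH : 0 ≤ H) (hD : 0 < D) (hHD : D ≤ H) (hM : 0 ≤ M) (hC : 0 ≤ C) (hCθ : 0 ≤ Cθ) (hCu : 1 ≤ Cu)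
    (hKE : 0 ≤ KE) (hB : 0 ≤ B) (hσ : 0 < σ) (hCY : 0 ≤ CY) (hη₀g : 0 ≤ η₀g) (hηcap : 0 ≤ ηcap) (hroom : 0 < room)
    {Pmod PmodX : ℝ → ℝ → Prop} (Hmod : ∀ ω : ℝ, 0 < ω → ∃ d : ℝ, 0 < d ∧ Pmod ω d)
    (HmodX : ∀ ω : ℝ, 0 < ω → ∃ d : ℝ, 0 < d ∧ PmodX ω d)
    {PU : ℝ → ℝ → ℝ → Prop} (HU : ∀ e : ℝ, 0 < e → ∀ η₂ : ℝ, 0 < η₂ → ∃ Lv : ℝ, PU e η₂ Lv) :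
    ∃ ω d e η₂ Lv η₃ ωx dX lam ηW ηP ηL B3 ε₁ : ℝ, ∃ n n' : ℕ,
      0 < ω ∧ Pmod ω d ∧ 0 < d ∧ 0 < e ∧ e < d ∧ e ≤ room ∧ 0 < η₂ ∧ PU e η₂ Lv ∧ 0 < η₃ ∧ 0 < ωx ∧ 0 < dX ∧ PmodX ωx dX ∧
      0 < lam ∧ lam ≤ 1 ∧ 0 < ηW ∧ 0 < ηP ∧ 0 < ηL ∧ 0 < ε₁ ∧ 3 / 2 * Cu * ε₁ * (2 + 8 * KE) ≤ B3 ∧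
      1 ≤ n ∧ H / n ≤ e ∧ 1 ≤ n' ∧
      (ηW + ηP / 2 + B3 +
        3 / 2 * ωx * ((1 + max Lv 0) * (η₃ + σ ^ 3 * (3 * H * (3 / (2 * Real.pi) * CY) *
          (2 * Real.pi * (η₀g / σ ^ 3 + ηcap) * (1 / 2 + KE)))) + η₂) +
        H / n * ((60 * Cu + 2 * Cu * (1 + B)) * KE) +
        3 / 2 * Cu * ((1 + max Lv 0) * (η₃ + σ ^ 3 * (3 * (H / n) * (3 / (2 * Real.pi) * CY) *
          (2 * Real.pi * (η₀g / σ ^ 3 + ηcap) * (1 / 2 + KE)))) + η₂) +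
        ω * ((1 + 2 * KE) + H * ((7 + 2 * B) * KE + 1 / 2)) ≤ δ) ∧
      (ηL + (H * (M * (Cθ * (C / D * ((H - D) / n'))) * KE +
          (M * (Cθ * (C / D * ((H - D) / n')) + Cθ * (C / D ^ 2 * ((H - D) / n'))) +
            M * (Cθ * (C / D * ((H - D) / n'))) / 2)) +
        M * Cθ * (C / D * ((H - D) / n'))) +
      (H * (M * ω * KE + (M * (ω + ω * (C / D)) + M * ω / 2)) + M * ω) +
      (H - 0) * (2 * M * lam * ((Cθ * 1 + Cθ * (C / D)) + Cθ / 2) + 2 * M * lam * Cθ * KE + 0) ≤ δ) := by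
  have hCu0 : 0 < Cu := by linarith
  have hπ : 0 < Real.pi := Real.pi_pos
  -- ### ω (momentum term T7 and entropy term E₂), then `d`, then `e`
  obtain ⟨K₇, hK₇⟩ : ∃ K : ℝ, K = (1 + 2 * KE) + H * ((7 + 2 * B) * KE + 1 / 2) := ⟨_, rfl⟩
  have hK₇0 : 0 ≤ K₇ := by rw [hK₇]; positivity
  obtain ⟨K₂, hK₂⟩ : ∃ K : ℝ, K = H * (M * KE + (M * (1 + C / D) + M / 2)) + M := ⟨_, rfl⟩
  have hK₂0 : 0 ≤ K₂ := by rw [hK₂]; positivity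
  obtain ⟨ω, hωdef⟩ : ∃ ω : ℝ, ω = min (δ / 8 / (K₇ + 1)) (δ / 4 / (K₂ + 1)) := ⟨_, rfl⟩
  have hω : 0 < ω := by rw [hωdef]; positivity
  have hT7 : ω * ((1 + 2 * KE) + H * ((7 + 2 * B) * KE + 1 / 2)) ≤ δ / 8 := by
    rw [← hK₇]; exact (stub_reductionFinalA (by positivity) hK₇0 (hωdef ▸ min_le_left _ _)).1
  have hE2 : H * (M * ω * KE + (M * (ω + ω * (C / D)) + M * ω / 2)) + M * ω ≤ δ / 4 := by
    have h := (stub_reductionFinalA (by positivity) hK₂0 (hωdef ▸ min_le_right _ _)).1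
    have e : H * (M * ω * KE + (M * (ω + ω * (C / D)) + M * ω / 2)) + M * ω = ω * K₂ := by rw [hK₂]; ring
    linarith
  obtain ⟨d, hd, hPd⟩ := Hmod ω hω
  obtain ⟨e, hedef⟩ : ∃ e : ℝ, e = min (d / 2) room := ⟨_, rfl⟩
  have he : 0 < e := by rw [hedef]; positivity
  have hed : e < d := by have := min_le_left (d / 2) room; linarith
  have her : e ≤ room := hedef ▸ min_le_right _ _
  -- ### η₂, then the velocity level `Lv`, then η₃ and the grid `n`
  obtain ⟨η₂, hη₂def⟩ : ∃ η₂ : ℝ, η₂ = δ / (36 * Cu) := ⟨_, rfl⟩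
  have hη₂ : 0 < η₂ := by rw [hη₂def]; positivity
  have hη₂e : 3 / 2 * Cu * η₂ = δ / 24 := by rw [hη₂def]; field_simp; ring
  obtain ⟨Lv, hLv⟩ := HU e he η₂ hη₂
  have hL1 : 0 < 1 + max Lv 0 := by positivity
  obtain ⟨η₃, hη₃def⟩ : ∃ η₃ : ℝ, η₃ = δ / (36 * Cu * (1 + max Lv 0)) := ⟨_, rfl⟩
  have hη₃ : 0 < η₃ := by rw [hη₃def]; positivity
  have hη₃e : 3 / 2 * Cu * ((1 + max Lv 0) * η₃) = δ / 24 := by rw [hη₃def]; field_simp; ring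
  obtain ⟨Q, hQ⟩ : ∃ Q : ℝ, Q = σ ^ 3 * (3 * (3 / (2 * Real.pi) * CY) * (2 * Real.pi * (η₀g / σ ^ 3 + ηcap) * (1 / 2 + KE))) :=
    ⟨_, rfl⟩
  have hQ0 : 0 ≤ Q := by rw [hQ]; positivity
  obtain ⟨K₅, hK₅⟩ : ∃ K : ℝ, K = (60 * Cu + 2 * Cu * (1 + B)) * KE := ⟨_, rfl⟩
  have hK₅0 : 0 ≤ K₅ := by rw [hK₅]; positivity
  obtain ⟨K₆, hK₆⟩ : ∃ K : ℝ, K = 3 / 2 * Cu * (1 + max Lv 0) * Q := ⟨_, rfl⟩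
  have hK₆0 : 0 ≤ K₆ := by rw [hK₆]; positivity
  obtain ⟨n, hn, hnc⟩ := ChaosClosesEulerReduction.exists_nat_mesh_le H (c := min e (min (δ / 8 / (K₅ + 1)) (δ / 24 / (K₆ + 1)))) (by positivity)
  have hn0 : (0 : ℝ) < n := by exact_mod_cast hn
  have hHn0 : 0 ≤ H / n := by positivity
  have hne : H / n ≤ e := hnc.trans (min_le_left _ _)
  have hT5 : H / n * ((60 * Cu + 2 * Cu * (1 + B)) * KE) ≤ δ / 8 := by
    rw [← hK₅]
    exact (stub_reductionFinalA (by positivity) hK₅0 (hnc.trans ((min_le_right _ _).trans (min_le_left _ _)))).1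
  have hT6b : K₆ * (H / n) ≤ δ / 24 :=
    (stub_reductionFinalA (by positivity) hK₆0 (hnc.trans ((min_le_right _ _).trans (min_le_right _ _)))).2
  have hT6 : 3 / 2 * Cu * ((1 + max Lv 0) * (η₃ + σ ^ 3 * (3 * (H / n) * (3 / (2 * Real.pi) * CY) *
      (2 * Real.pi * (η₀g / σ ^ 3 + ηcap) * (1 / 2 + KE)))) + η₂) ≤ δ / 8 := by
    have e1 : 3 / 2 * Cu * ((1 + max Lv 0) * (η₃ + σ ^ 3 * (3 * (H / n) * (3 / (2 * Real.pi) * CY) *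
        (2 * Real.pi * (η₀g / σ ^ 3 + ηcap) * (1 / 2 + KE)))) + η₂) =
        3 / 2 * Cu * ((1 + max Lv 0) * η₃) + K₆ * (H / n) + 3 / 2 * Cu * η₂ := by rw [hK₆, hQ]; ring
    linarith
  -- ### ωx (momentum term T4), then `dX`
  obtain ⟨Q₄, hQ₄⟩ : ∃ Q₄ : ℝ, Q₄ = (1 + max Lv 0) * (η₃ + σ ^ 3 * (3 * H * (3 / (2 * Real.pi) * CY) *
      (2 * Real.pi * (η₀g / σ ^ 3 + ηcap) * (1 / 2 + KE)))) + η₂ := ⟨_, rfl⟩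
  have hQ₄0 : 0 ≤ Q₄ := by rw [hQ₄]; positivity
  obtain ⟨ωx, hωxdef⟩ : ∃ ωx : ℝ, ωx = δ / 8 / (3 / 2 * Q₄ + 1) := ⟨_, rfl⟩
  have hωx : 0 < ωx := by rw [hωxdef]; positivity
  have hT4 : 3 / 2 * ωx * ((1 + max Lv 0) * (η₃ + σ ^ 3 * (3 * H * (3 / (2 * Real.pi) * CY) *
      (2 * Real.pi * (η₀g / σ ^ 3 + ηcap) * (1 / 2 + KE)))) + η₂) ≤ δ / 8 := by
    rw [← hQ₄]
    have h := (stub_reductionFinalA (by positivity) (by positivity : 0 ≤ 3 / 2 * Q₄) hωxdef.le).1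
    linarith
  obtain ⟨dX, hdX, hPdX⟩ := HmodX ωx hωx
  -- ### the entropy grid `n'` and the thinness level `lam`
  obtain ⟨K₁, hK₁⟩ : ∃ K : ℝ, K = H * (M * (Cθ * (C / D)) * KE + (M * (Cθ * (C / D) + Cθ * (C / D ^ 2)) + M * (Cθ * (C / D)) / 2)) +
      M * Cθ * (C / D) := ⟨_, rfl⟩
  have hK₁0 : 0 ≤ K₁ := by rw [hK₁]; positivity
  obtain ⟨n', hn', hn'c⟩ := ChaosClosesEulerReduction.exists_nat_mesh_le (H - D) (c := δ / 4 / (K₁ + 1)) (by positivity)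
  have hn'0 : (0 : ℝ) < n' := by exact_mod_cast hn'
  have hμ0 : 0 ≤ (H - D) / n' := div_nonneg (by linarith) hn'0.le
  have hE1 : H * (M * (Cθ * (C / D * ((H - D) / n'))) * KE +
        (M * (Cθ * (C / D * ((H - D) / n')) + Cθ * (C / D ^ 2 * ((H - D) / n'))) +
          M * (Cθ * (C / D * ((H - D) / n'))) / 2)) +
      M * Cθ * (C / D * ((H - D) / n')) ≤ δ / 4 := by
    have h := (stub_reductionFinalA (by positivity) hK₁0 hn'c).1
    have e1 : H * (M * (Cθ * (C / D * ((H - D) / n'))) * KE +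
          (M * (Cθ * (C / D * ((H - D) / n')) + Cθ * (C / D ^ 2 * ((H - D) / n'))) +
            M * (Cθ * (C / D * ((H - D) / n'))) / 2)) +
        M * Cθ * (C / D * ((H - D) / n')) = (H - D) / n' * K₁ := by rw [hK₁]; ring
    linarith
  obtain ⟨K₃, hK₃⟩ : ∃ K : ℝ, K = H * (2 * M * ((Cθ * 1 + Cθ * (C / D)) + Cθ / 2) + 2 * M * Cθ * KE) := ⟨_, rfl⟩
  have hK₃0 : 0 ≤ K₃ := by rw [hK₃]; positivity
  obtain ⟨lam, hlamdef⟩ : ∃ lam : ℝ, lam = min 1 (δ / 4 / (K₃ + 1)) := ⟨_, rfl⟩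
  have hlam : 0 < lam := by rw [hlamdef]; positivity
  have hlam1 : lam ≤ 1 := hlamdef ▸ min_le_left _ _
  have hE3 : (H - 0) * (2 * M * lam * ((Cθ * 1 + Cθ * (C / D)) + Cθ / 2) + 2 * M * lam * Cθ * KE + 0) ≤ δ / 4 := by
    have h := (stub_reductionFinalA (by positivity) hK₃0 (hlamdef ▸ min_le_right _ _)).1
    have e1 : (H - 0) * (2 * M * lam * ((Cθ * 1 + Cθ * (C / D)) + Cθ / 2) + 2 * M * lam * Cθ * KE + 0) = lam * K₃ := by
      rw [hK₃]; ring
    linarith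
  -- ### the remaining levels and the two budgets
  obtain ⟨ε₁, hε₁def⟩ : ∃ ε₁ : ℝ, ε₁ = δ / (12 * Cu * (2 + 8 * KE)) := ⟨_, rfl⟩
  have hε₁ : 0 < ε₁ := by rw [hε₁def]; positivity
  have hB3 : 3 / 2 * Cu * ε₁ * (2 + 8 * KE) ≤ δ / 8 := by
    have e1 : 3 / 2 * Cu * ε₁ * (2 + 8 * KE) = δ / 8 := by rw [hε₁def]; field_simp; ring
    exact e1.le
  refine ⟨ω, d, e, η₂, Lv, η₃, ωx, dX, lam, δ / 8, δ / 4, δ / 4, δ / 8, ε₁, n, n', hω, hPd, hd, he, hed, her, hη₂, hLv, hη₃,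
    hωx, hdX, hPdX, hlam, hlam1, by positivity, by positivity, by positivity, hε₁, hB3, hn, hne, hn', ?_, ?_⟩
  · linarith
  · linarith

end Summit.AtomisticToContinuum.HydrodynamicLimit.Theorems.ChaosClosesEulerKineticReduction
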